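import Literature.NumberTheory.Automorphic.QuaternionAlgebraSplitting
import Literature.NumberTheory.Automorphic.QuaternionAlgebraStructure
import Literature.NumberTheory.Automorphic.AdicCompletionUnitNorms
import HarnessLib

/-!
# Finiteness of the set of ramified places of a quaternion algebra

Companion ("proofs") file of `Literature.NumberTheory.Automorphic.QuaternionAlgebraAdelic`
(namespace `Literature.Automorphic`), all declarations fully proved. It discharges the named fact

* `ramifiedPlaces_finite` — for a quaternion algebra `D` over a number field `K` (central simple
  of dimension `4`, `IsQuaternionAlgebra K D`) the set `ramifiedPlaces K D` of finite places `v`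
  at which `D` is not split (`K_v ⊗_K D ≄ M₂(K_v)`) is finite:
  `ramifiedPlaces_finite_holds`.

Source: M.-F. Vignéras, *Arithmétique des algèbres de quaternions*, LNM 800, Ch. III §1
(Adèles), Lemme 1.1 (p. 58): "Le nombre de places de K ramifiées dans H est fini", a place `v`
being ramified in `H` when `H_v = H ⊗ K_v` is a division algebra (Définition preceding the
lemma), i.e. — a quaternion algebra over `K_v` being either a division algebra or `M(2, K_v)`
(I §2 Cor. 2.4) — when `H_v` is not split. (The docstring of the named fact locates the lemma
as "III §3, Lemme 3.1"; in the book it is Lemme 1.1 of Ch. III §1, the first numbered statement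
of the chapter, followed by Lemme 1.2, Proposition 1.3 and the Théorème fondamental 1.4 cited by
`AdelicGroupData.compactSpace_automorphicQuotient_units`. The statement formalised — finite
places only — is the one printed, restricted to the finite places; the infinite places are
finitely many anyway.)

## Proof

Vignéras proves the lemma with orders: a `K`-basis of `H` spans, for almost all `v`, an
`R_v`-order of reduced discriminant `R_v`, hence (Ch. II) `H_v = M(2, K_v)`. The proof given
here is the equally classical one through the Hilbert symbol (Vignéras III §1, Exemple after
the Définition: "une place `v` se ramifie dans `{a, b}` si et seulement si `(a,b)_v = -1`", and
II §1, Lemme 1.10 with the table of the tame symbol), all of whose steps are available: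

1. `IsQuaternionAlgebra.exists_algEquiv_quaternionAlgebra`
   (`QuaternionAlgebraStructure.lean`; Vignéras I §1 p. 2): `D ≃ₐ[K] ℍ[K,a,b]` for some
   `a, b ∈ K×`, and splitting is invariant under `K`-isomorphism (`IsSplitAt.of_algEquiv`);
2. `isSplitAt_quaternionAlgebra_iff` (`QuaternionAlgebraSplitting.lean`; Vignéras I §2
   Cor. 2.4 over `K_v`): `ℍ[K,a,b]` is split at `v` iff `x² - a y² = b` is soluble in `K_v`;
3. `exists_sq_sub_mul_sq_of_valuation_eq_one` (`AdicCompletionUnitNorms.lean`; Vignéras II §1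
   Lemme 1.10, Hensel's lemma in `𝒪_v`): this equation is soluble whenever
   `v(a) = v(b) = v(2) = 0`;
4. `finite_setOf_valuation_ne_one`: for `c ∈ K×` the set of finite places with `v(c) ≠ 0` is
   finite (Mathlib `IsDedekindDomain.HeightOneSpectrum.Support.finite`, applied to `c` and `c⁻¹`).

Hence `ramifiedPlaces K D ⊆ {v : v(a) ≠ 0} ∪ {v : v(b) ≠ 0} ∪ {v : v(2) ≠ 0}` is finite.

## References

* M.-F. Vignéras, *Arithmétique des algèbres de quaternions*, LNM 800, Springer (1980),
  doi:10.1007/BFb0091027: Ch. III §1 Définition and Lemme 1.1 (p. 57–58), Exemple (ramification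
  of `{a, b}` via the Hilbert symbol); Ch. II §1 Lemme 1.10; Ch. I §1 p. 2, §2 Cor. 2.4.
-/

noncomputable section

open NumberField IsDedekindDomain
open scoped TensorProduct Quaternion

namespace Literature.NumberTheory.Automorphic

section NumberField

variable (K : Type) [Field K] [NumberField K]

/-- For a non-zero element `c` of a number field `K`, the set of finite places `v` with
`v(c) ≠ 0` (multiplicatively: `v.valuation K c ≠ 1`) is finite: it is contained in the union of
the supports of `c` and of `c⁻¹` (Mathlib `IsDedekindDomain.HeightOneSpectrum.Support.finite`:
the places where an element is not integral form a finite set). Vignéras III §1: "pour presque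
toute place `i_v(x) ∈ R_v`". [folklore] -/
theorem finite_setOf_valuation_ne_one {c : K} (hc : c ≠ 0) :
    {v : HeightOneSpectrum (𝓞 K) | v.valuation K c ≠ 1}.Finite := by
  refine ((HeightOneSpectrum.Support.finite (𝓞 K) c).union
    (HeightOneSpectrum.Support.finite (𝓞 K) c⁻¹)).subset fun v hv ↦ ?_
  simp only [Set.mem_setOf_eq, Set.mem_union, HeightOneSpectrum.Support, map_inv₀] at hv ⊢
  rcases hv.lt_or_gt with h | h
  · exact Or.inr ((one_lt_inv₀ ((Valuation.pos_iff _).mpr hc)).mpr h)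
  · exact Or.inl h

variable (D : Type*) [Ring D] [Algebra K D]

/-- Being split at a finite place is invariant under `K`-algebra isomorphisms `D ≃ₐ[K] D'`:
`K_v ⊗_K D ≃ₐ[K_v] K_v ⊗_K D'` (Mathlib `Algebra.TensorProduct.congr`, `K_v`-linear in the left
factor). [folklore] -/
theorem IsSplitAt.of_algEquiv {D' : Type*} [Ring D'] [Algebra K D'] (e : D ≃ₐ[K] D')
    (v : HeightOneSpectrum (𝓞 K)) (h : IsSplitAt D' v) : IsSplitAt D v := by
  obtain ⟨f⟩ := h
  exact ⟨((ScalarExtension.ofTensor K _ D).symm.trans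
    ((Algebra.TensorProduct.congr
      (AlgEquiv.refl : v.adicCompletion K ≃ₐ[v.adicCompletion K] v.adicCompletion K) e).trans
      (ScalarExtension.ofTensor K _ D'))).trans f⟩

/-- **Discharge** of `ramifiedPlaces_finite` (Vignéras, LNM 800, Ch. III §1, Lemme 1.1, p. 58:
"Le nombre de places de K ramifiées dans H est fini"; the fact's own docstring says "III §3
Lemme 3.1", same lemma): for a quaternion algebra `D` over a number field `K`, the set of finite
places `v` with `K_v ⊗_K D ≄ M₂(K_v)` is finite. Proof (through the tame Hilbert symbol rather
than the book's maximal orders, see the module docstring): `D ≃ ℍ[K,a,b]` with `a b ≠ 0`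
(`IsQuaternionAlgebra.exists_algEquiv_quaternionAlgebra`); outside the finite set of places where
one of `a, b, 2` is not a `v`-unit (`finite_setOf_valuation_ne_one`), `x² - a y² = b` is soluble in
`K_v` (`exists_sq_sub_mul_sq_of_valuation_eq_one`), so `ℍ[K,a,b]`, hence `D`, is split at `v`
(`isSplitAt_quaternionAlgebra_iff`, `IsSplitAt.of_algEquiv`).
[cite: VignerasLNM800, Ch. III §1 Lemme 1.1 (p. 58)] -/
theorem ramifiedPlaces_finite_holds : ramifiedPlaces_finite K D := by
  intro _
  haveI : NeZero (2 : K) := ⟨two_ne_zero⟩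
  obtain ⟨a, b, ha, hb, ⟨e⟩⟩ := IsQuaternionAlgebra.exists_algEquiv_quaternionAlgebra K D
  refine (((finite_setOf_valuation_ne_one K ha).union (finite_setOf_valuation_ne_one K hb)).union
    (finite_setOf_valuation_ne_one K (two_ne_zero (α := K)))).subset fun v hv ↦ ?_
  by_contra hvS
  simp only [Set.mem_union, Set.mem_setOf_eq, not_or, not_not] at hvS
  obtain ⟨⟨hva, hvb⟩, hv2⟩ := hvS
  exact hv (IsSplitAt.of_algEquiv K D e v ((isSplitAt_quaternionAlgebra_iff K ha hb v).mpr
    (exists_sq_sub_mul_sq_of_valuation_eq_one v hva hvb hv2)))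

end NumberField

end Literature.NumberTheory.Automorphic
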